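import Summits.BirchSwinnertonDyer.Rank1Residual.X2.Cells
import Literature.NumberTheory.EllipticCurves.GreenbergVatsal2000.MultiplicativeReduction
import Literature.NumberTheory.EllipticCurves.Rank1Residual.Typed.MultiplicativeRankZero
import Literature.NumberTheory.EllipticCurves.Rank1Residual.Typed.PAdicCertificateMultiplicativeExists
import Literature.NumberTheory.EllipticCurves.PAdicLFunctionNonsplitMultiplicativeExistenceProofs
import Literature.NumberTheory.EllipticCurves.PAdicHeightsLInvariantHoldsProofs
import Literature.NumberTheory.EllipticCurves.PAdicBSDSplitMultiplicativeProofs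
import Literature.NumberTheory.EllipticCurves.PAdicHeightsProofs
import Literature.NumberTheory.EllipticCurves.KatoRankBoundProofs
import Literature.NumberTheory.EllipticCurves.IwasawaSelmerDualProofs
import Literature.NumberTheory.EllipticCurves.LeadingTermPPartProofs
import Literature.NumberTheory.EllipticCurves.ModularCurve
import HarnessLib

/-!
# Class X2, rank `0`: `BSD(E,p)` from Mazur's main conjecture at `(E,p)`, and the Greenberg–Vatsal
# sub-cell X2a CLOSED from published named facts (cell `b2b-bsdres`, unit `b2b-bsdres-eisenstein-p2`)

HONEST FRAMING (run/shared/lean/b2b/bsd-rank1-residual/, verbatim in every file): the goal of the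
cell is to DELETE the COMBINATION-SHAPED residual classes of the Birch–Swinnerton-Dyer formula for
ALL analytic-rank `≤ 1` elliptic curves over `ℚ` — "full BSD formula for every rank `≤ 1` curve in
class `C`" assembled STRICTLY from published theorems — so that the rank-`≤ 1` remainder becomes
exactly the CONSTRUCTION-SHAPED classes, which are TYPED (missing-input `Prop`s), NOT attempted.
This is not "finishing BSD". Research routes; no claim beyond stated classes.

Theorems only (no definition, no named fact). Inputs are PUBLISHED named facts of the tree, each
taken as an explicit hypothesis (nothing is asserted), plus tree theorems:

| binder | fact (tree decl) | source | status |
|---|---|---|---|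
| `hGV` | `GreenbergVatsal2000.lambdaMu_multiplicative_of_gvPar` | Greenberg–Vatsal, Invent. Math. 142 (2000) pp. 1, 14–15, §2 (16), §3 Prop. 3.1/3.3/L. 3.6/P. 3.7/C. 3.8/Thm. 3.11 + Greenberg LNM 1716 Prop. 5.10 | PUB, flag `GV00-mult-asserted` (referee to rule) |
| `hWu` | `Wuthrich2014.thm16_charIdeal_dvd_multiplicative_of_reducible` | Wuthrich, Doc. Math. 19 (2014) Thm. 16 | PUB |
| `hJs`/`hJn` | `SteinWuthrich2013.thm61_{split,nonsplit}Multiplicative` | Stein–Wuthrich, Math. Comp. 82 (2013) Thm. 6.1 (Jones 1989) | PUB |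
| `hHs`/`hHn` | `SteinWuthrich2013.exists_isSplitMultCanonical` / `exists_isMultCanonical` | SW 2013 §4.2 (Schneider / Werner) | PUB |
| `hGS` | `greenberg_stevens` | Greenberg–Stevens, Invent. Math. 111 (1993); Kobayashi 2006 Cor. 4.2 | PUB |
| `hGZK` | `rank_eq_analyticRank_of_analyticRank_le_one` | Gross–Zagier–Kolyvagin (bsd.S17) | PUB |
| `hmod`/`hpar` | `hasEntireLFunction_rat` / `nonempty_modularParametrizationData` | modularity (Wiles, BCDT) | PUB |

and the tree THEOREMS `LInvariant_ne_zero_holds` (Barré-Sirieix–Diaz–Gramain–Philibert),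
`exists_isSplitMultPAdicLFunctionOf`, `exists_isMultPAdicLFunctionOf_neg_one_of_nonsplit` (MTT),
`nonempty_tateParameterData_iff_holds`, `existsUnique_tateJ_eq_of_one_lt_norm` (Tate),
`exists_isCyclotomic_isTopGenerator_isCyclotomicVariable_holds`, `nonempty_selmerDualData_holds`,
`Rank1Residual.Typed.bsdp_of_multCharIdeal_{split,nonsplit}_rankZero` (the rank-`0` glue, x11a gen 8).

Contents:
* `X2.bsdp_of_mazurMainConjectureAt_of_analyticRank_eq_zero` — for EVERY rank-`0` pair at an odd
  multiplicative prime (both sub-cells X2a and X2b, and indeed irreducible `E[p]` too): Mazur's main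
  conjecture at the pair (`X2.MazurMainConjectureAt`) ⇒ `BSD(E,p)`. This is the kernel statement
  "the rank-`0` missing input of X2 is EXACTLY Mazur's main conjecture at `(E,p)`".
* `X2.mazurMainConjectureAt_of_gvPar` — on sub-cell X2a the main conjecture is supplied by
  Greenberg–Vatsal (`hGV`) + Wuthrich Thm. 16 (`hWu`) (`GreenbergVatsal2000.mainConjecture_{split,nonsplit}_of_gvPar`).
* `X2.targetA_of_published` — **sub-cell X2a is closed from published facts**:
  `∀ W p, r_an = 0 → ClassX2 W p → GVPar W p → BSDp W p` under the binders above.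
* `X2.targetB_of_missingInputB`, `X2.target_of_published_of_missingInputs` — the class statement of
  record from the published facts plus the two typed missing inputs (X2b: Mazur's main conjecture
  at the pair; X2c: `MissingPPartAt`).
-/

set_option autoImplicit false

noncomputable section

open scoped Classical MatrixGroups ModularForm

open CongruenceSubgroup WeierstrassCurve Literature.NumberTheory.EllipticCurves
  Literature.NumberTheory.EllipticCurves.ModularForms
  Literature.NumberTheory.EllipticCurves.Rank1Residual
  Literature.NumberTheory.EllipticCurves.Rank1Residual.Typed
  Literature.NumberTheory.EllipticCurves.GreenbergVatsal2000
  Literature.NumberTheory.EllipticCurves.Wuthrich2014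
  Literature.NumberTheory.EllipticCurves.SteinWuthrich2013

namespace Summit.BirchSwinnertonDyer.Rank1Residual.X2

/-! ### Rank `0`: Mazur's main conjecture at the pair ⇒ `BSD(E,p)` -/

/-- **Rank `0` at an odd multiplicative prime: Mazur's main conjecture at `(E,p)` gives `BSD(E,p)`.**
For `W/ℚ` globally minimal elliptic with `ord_{s=1} L(E,s) = 0` and `p ≠ 2` of multiplicative
reduction, `X2.MazurMainConjectureAt W p` (for all data: `char_Λ X = (g)`, `ι(T^e·g·w) = ϖ·L`)
implies Miller's `BSD(E,p)`: the data are INSTANTIATED from tree theorems (cyclotomic `(κ,γ)`,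
`X(E/ℚ_∞)`, the newform and `ϖ` from the modular parametrisation `hpar`, THE Mazur–Tate–Teitelbaum
function, the Tate parameter) and fed to the rank-`0` glue
`Typed.bsdp_of_multCharIdeal_{split,nonsplit}_rankZero` (Stein–Wuthrich Thm. 6.1 `hJs`/`hJn`, height
existence `hHs`/`hHn`, Greenberg–Stevens `hGS`, `𝓛_p ≠ 0`, GZK `hGZK`, modularity `hmod`). No
reducibility or image hypothesis. [cite: SteinWuthrich2013, Thm. 6.1 (p. 20) and §4.2]
[cite: Skinner2016PacificMC, §3.2–3.3] [cite: Miller2011LMS, Def. 1.1 and §1] -/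
theorem bsdp_of_mazurMainConjectureAt_of_analyticRank_eq_zero
    (hJs : thm61_splitMultiplicative) (hJn : thm61_nonsplitMultiplicative)
    (hHs : exists_isSplitMultCanonical) (hHn : exists_isMultCanonical)
    (hGZK : rank_eq_analyticRank_of_analyticRank_le_one) (hmod : hasEntireLFunction_rat)
    (hpar : nonempty_modularParametrizationData)
    (W : WeierstrassCurve ℚ) [W.IsElliptic] [W.IsGloballyMinimal] (p : ℕ) [Fact p.Prime]
    (hGS : greenberg_stevens (W := W) (p := p))
    (hp : p ≠ 2) (hmult : W.HasMultiplicativeReductionAtPrime p) (hr : W.analyticRank = 0)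
    (hMC : MazurMainConjectureAt W p) : BSDp W p := by
  obtain ⟨κ, hκ, γ, hγ, hγ'⟩ := exists_isCyclotomic_isTopGenerator_isCyclotomicVariable_holds p
  obtain ⟨D⟩ := W.nonempty_selmerDualData_holds κ γ hγ
  haveI : NeZero (W.conductorNorm ℤ) := ⟨(W.conductorNorm_pos_holds).ne'⟩
  obtain ⟨Dm⟩ := hpar W
  obtain ⟨ϖ, hϖpos, hϖ, -⟩ := Dm.exists_rat_mul_realPeriodRat_eq_plusPeriod
  obtain ⟨hX, g, hchar, hsp, hnsp⟩ := hMC κ γ hκ hγ hγ' Dm.f Dm.isNewformOf D ϖ hϖ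
  by_cases hsplit : W.HasSplitMultiplicativeReductionAtPrime p
  · obtain ⟨L, hL⟩ := exists_isSplitMultPAdicLFunctionOf hsplit Dm.isNewformOf
    obtain ⟨Dq⟩ := (nonempty_tateParameterData_iff_holds (W := W) (p := p)).mpr hsplit
    obtain ⟨w, hw⟩ := hsp hsplit L hL
    exact bsdp_of_multCharIdeal_split_rankZero hJs hHs hGZK hmod W p hGS LInvariant_ne_zero_holds
      hp hr Dq hκ hγ hγ' Dm.isNewformOf D ϖ hϖpos.ne' hϖ L hL ⟨hX, g, w, hchar, hw⟩
  · obtain ⟨L, hL⟩ := exists_isMultPAdicLFunctionOf_neg_one_of_nonsplit Dm.isNewformOf hmult hsplit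
    obtain ⟨q, ⟨hq0, hq1, hqj⟩, -⟩ := existsUnique_tateJ_eq_of_one_lt_norm
      (one_lt_norm_j_of_hasMultiplicativeReductionAtPrime (W := W) (p := p) hmult)
    obtain ⟨w, hw⟩ := hnsp hsplit L hL
    exact bsdp_of_multCharIdeal_nonsplit_rankZero hJn hHn hGZK hmod W p hp hr hmult hsplit hq0 hq1
      hqj hκ hγ hγ' Dm.isNewformOf D ϖ hϖpos.ne' hϖ L hL ⟨hX, g, w, hchar, hw⟩

/-! ### Sub-cell X2a: the main conjecture from Greenberg–Vatsal + Wuthrich -/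

/-- **On sub-cell X2a, Mazur's main conjecture at `(E,p)` holds** (from the named facts
Greenberg–Vatsal 2000 at a multiplicative prime, `hGV`, and Wuthrich 2014 Thm. 16, `hWu`): for
`p ≠ 2` multiplicative with `GVPar W p`, `X2.MazurMainConjectureAt W p`
(`GreenbergVatsal2000.mainConjecture_{split,nonsplit}_of_gvPar`).
[cite: GreenbergVatsal2000, p. 20 (arXiv p. 4) and pp. 14–15] [cite: Wuthrich2014, Thm. 16 (p. 397)] -/
theorem mazurMainConjectureAt_of_gvPar (hGV : lambdaMu_multiplicative_of_gvPar)
    (hWu : thm16_charIdeal_dvd_multiplicative_of_reducible)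
    (W : WeierstrassCurve ℚ) [W.IsElliptic] [W.IsGloballyMinimal] (p : ℕ) [Fact p.Prime]
    (hp : p ≠ 2) (hmult : W.HasMultiplicativeReductionAtPrime p) (hgv : GVPar W p) :
    MazurMainConjectureAt W p := by
  intro κ γ hκ hγ hγ' N _ f hf D ϖ hϖ
  have hred : ¬ W.HasIrreducibleModPGaloisRep p := by
    obtain ⟨Φ, hΦ, -⟩ := hgv
    exact not_hasIrreducibleModPGaloisRep_of_isRationalLine hΦ
  by_cases hsplit : W.HasSplitMultiplicativeReductionAtPrime p
  · -- split: generator and unit from the split derivation; the non-split clause is vacuous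
    refine ⟨(hWu W p hp hmult hred hκ hγ hγ' hf D ϖ hϖ).1, ?_⟩
    -- one generator serving every `L` (the `L` is unique anyway): take it from `char X` principal
    haveI : (Literature.NumberTheory.EllipticCurves.Module.charIdeal (IwasawaAlgebra p) D.X).IsPrincipal :=
      charIdeal_isPrincipal_holds p D.X
    obtain ⟨g₀, hg₀⟩ :=
      Submodule.IsPrincipal.principal (Literature.NumberTheory.EllipticCurves.Module.charIdeal (IwasawaAlgebra p) D.X)
    have hchar₀ : D.charIdeal = Ideal.span {g₀} := hg₀
    refine ⟨g₀, hchar₀, fun hs L hL => ?_, fun hns => absurd hsplit hns⟩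
    obtain ⟨-, g, w, hchar, hw⟩ :=
      mainConjecture_split_of_gvPar hGV hWu W p hp hs hgv hκ hγ hγ' hf D ϖ hϖ L hL
    -- `(g) = (g₀)`: `g = g₀ * u` for a unit `u`
    obtain ⟨u, hu⟩ := Ideal.span_singleton_eq_span_singleton.mp (hchar.symm.trans hchar₀).symm
    refine ⟨u * w, ?_⟩
    rw [← hw, ← hu]
    congr 1
    push_cast
    ring
  · refine ⟨(hWu W p hp hmult hred hκ hγ hγ' hf D ϖ hϖ).1, ?_⟩
    haveI : (Literature.NumberTheory.EllipticCurves.Module.charIdeal (IwasawaAlgebra p) D.X).IsPrincipal :=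
      charIdeal_isPrincipal_holds p D.X
    obtain ⟨g₀, hg₀⟩ :=
      Submodule.IsPrincipal.principal (Literature.NumberTheory.EllipticCurves.Module.charIdeal (IwasawaAlgebra p) D.X)
    have hchar₀ : D.charIdeal = Ideal.span {g₀} := hg₀
    refine ⟨g₀, hchar₀, fun hs => absurd hs hsplit, fun hns L hL => ?_⟩
    obtain ⟨-, g, w, hchar, hw⟩ :=
      mainConjecture_nonsplit_of_gvPar hGV hWu W p hp hmult hns hgv hκ hγ hγ' hf D ϖ hϖ L hL
    obtain ⟨u, hu⟩ := Ideal.span_singleton_eq_span_singleton.mp (hchar.symm.trans hchar₀).symm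
    refine ⟨u * w, ?_⟩
    rw [← hw, ← hu]
    congr 1
    push_cast
    ring

/-- **Sub-cell X2a of class X2 is CLOSED from published named facts**: for every `E/ℚ` (globally
minimal `W`) with `ord_{s=1} L(E,s) = 0` and every odd prime `p ‖ N` with `E[p]` reducible such that
some rational `p`-isogeny kernel is ramified-at-`p`-and-even or unramified-at-`p`-and-odd,
`BSD(E,p)` holds — granted the PUBLISHED named facts in the binders (Greenberg–Vatsal 2000 at a
multiplicative prime with Greenberg 1999 Prop. 5.10 [flag `GV00-mult-asserted`], Wuthrich 2014
Thm. 16, Stein–Wuthrich 2013 Thm. 6.1 + §4.2, Greenberg–Stevens, Gross–Zagier–Kolyvagin, modularity).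
The multiplicative twin of covered row C7 (Greenberg–Vatsal chain at a good ordinary prime).
[cite: GreenbergVatsal2000, Thm. (1.3) with pp. 1, 14–15, §3 Thm. (3.11)] [cite: GreenbergLNM1716, Prop. 5.10 (PDF p. 147)]
[cite: Wuthrich2014, Thm. 16 (p. 397)] [cite: SteinWuthrich2013, Thm. 6.1 (p. 20)] -/
theorem targetA_of_published (hGV : lambdaMu_multiplicative_of_gvPar)
    (hWu : thm16_charIdeal_dvd_multiplicative_of_reducible)
    (hJs : thm61_splitMultiplicative) (hJn : thm61_nonsplitMultiplicative)
    (hHs : exists_isSplitMultCanonical) (hHn : exists_isMultCanonical)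
    (hGZK : rank_eq_analyticRank_of_analyticRank_le_one) (hmod : hasEntireLFunction_rat)
    (hpar : nonempty_modularParametrizationData)
    (hGS : ∀ (W : WeierstrassCurve ℚ) [W.IsElliptic] [W.IsGloballyMinimal] (p : ℕ) [Fact p.Prime],
      greenberg_stevens (W := W) (p := p)) :
    TargetA := by
  intro W _ _ p _ hc
  obtain ⟨hr, ⟨hp, -, hmult⟩, hgv⟩ := hc
  exact bsdp_of_mazurMainConjectureAt_of_analyticRank_eq_zero hJs hJn hHs hHn hGZK hmod hpar W p
    (hGS W p) hp hmult hr (mazurMainConjectureAt_of_gvPar hGV hWu W p hp hmult hgv)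

/-- The same, spelled on the cell's predicates without the `CellA` wrapper:
`r_an = 0 → ClassX2 W p → GVPar W p → BSDp W p`.
[cite: GreenbergVatsal2000, Thm. (1.3) with pp. 1, 14–15] [cite: Wuthrich2014, Thm. 16 (p. 397)] -/
theorem bsdp_of_classX2_of_gvPar_of_analyticRank_eq_zero (hGV : lambdaMu_multiplicative_of_gvPar)
    (hWu : thm16_charIdeal_dvd_multiplicative_of_reducible)
    (hJs : thm61_splitMultiplicative) (hJn : thm61_nonsplitMultiplicative)
    (hHs : exists_isSplitMultCanonical) (hHn : exists_isMultCanonical)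
    (hGZK : rank_eq_analyticRank_of_analyticRank_le_one) (hmod : hasEntireLFunction_rat)
    (hpar : nonempty_modularParametrizationData)
    (W : WeierstrassCurve ℚ) [W.IsElliptic] [W.IsGloballyMinimal] (p : ℕ) [Fact p.Prime]
    (hGS : greenberg_stevens (W := W) (p := p))
    (hr : W.analyticRank = 0) (hX : ClassX2 W p) (hgv : GVPar W p) : BSDp W p :=
  bsdp_of_mazurMainConjectureAt_of_analyticRank_eq_zero hJs hJn hHs hHn hGZK hmod hpar W p hGS hX.1
    hX.2.2 hr (mazurMainConjectureAt_of_gvPar hGV hWu W p hX.1 hX.2.2 hgv)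

/-! ### Sub-cell X2b and the class statement of record, from the typed inputs -/

/-- Sub-cell X2b's target from its typed missing input (Mazur's main conjecture at each X2b pair —
OPEN, nothing in print) and the published rank-`0` inputs. [cite: Miller2011LMS, Def. 1.1 and §1] -/
theorem targetB_of_missingInputB
    (hJs : thm61_splitMultiplicative) (hJn : thm61_nonsplitMultiplicative)
    (hHs : exists_isSplitMultCanonical) (hHn : exists_isMultCanonical)
    (hGZK : rank_eq_analyticRank_of_analyticRank_le_one) (hmod : hasEntireLFunction_rat)
    (hpar : nonempty_modularParametrizationData)
    (hGS : ∀ (W : WeierstrassCurve ℚ) [W.IsElliptic] [W.IsGloballyMinimal] (p : ℕ) [Fact p.Prime],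
      greenberg_stevens (W := W) (p := p))
    (hmiss : ∀ (W : WeierstrassCurve ℚ) [W.IsElliptic] [W.IsGloballyMinimal] (p : ℕ) [Fact p.Prime],
      CellB W p → MissingInputB W p) :
    TargetB := by
  intro W _ _ p _ hc
  exact bsdp_of_mazurMainConjectureAt_of_analyticRank_eq_zero hJs hJn hHs hHn hGZK hmod hpar W p
    (hGS W p) hc.2.1.1 hc.2.1.2.2 hc.1 (hmiss W p hc)

/-- **The class statement of record for X2 from the published facts and the two typed missing
inputs** (X2b: Mazur's main conjecture at the pair; X2c: the rank-one `p`-part output): the exact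
shape of what remains of X2 after this file — sub-cell X2a needs nothing further.
[cite: Miller2011LMS, Def. 1.1 and §1] -/
theorem target_of_published_of_missingInputs (hGV : lambdaMu_multiplicative_of_gvPar)
    (hWu : thm16_charIdeal_dvd_multiplicative_of_reducible)
    (hJs : thm61_splitMultiplicative) (hJn : thm61_nonsplitMultiplicative)
    (hHs : exists_isSplitMultCanonical) (hHn : exists_isMultCanonical)
    (hGZK : rank_eq_analyticRank_of_analyticRank_le_one) (hmod : hasEntireLFunction_rat)
    (hpar : nonempty_modularParametrizationData)
    (hGS : ∀ (W : WeierstrassCurve ℚ) [W.IsElliptic] [W.IsGloballyMinimal] (p : ℕ) [Fact p.Prime],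
      greenberg_stevens (W := W) (p := p))
    (hmissB : ∀ (W : WeierstrassCurve ℚ) [W.IsElliptic] [W.IsGloballyMinimal] (p : ℕ) [Fact p.Prime],
      CellB W p → MissingInputB W p)
    (hmissC : ∀ (W : WeierstrassCurve ℚ) [W.IsElliptic] [W.IsGloballyMinimal] (p : ℕ) [Fact p.Prime],
      CellC W p → MissingInputC W p) :
    Target :=
  target_of_targets (targetA_of_published hGV hWu hJs hJn hHs hHn hGZK hmod hpar hGS)
    (targetB_of_missingInputB hJs hJn hHs hHn hGZK hmod hpar hGS hmissB)
    (targetC_of_missingInputC hGZK hmissC)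

end Summit.BirchSwinnertonDyer.Rank1Residual.X2

end
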